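import Summits.BirchSwinnertonDyer.Rank1Residual.Additive.X4RankZeroCoveredLocusManinFree
import Summits.BirchSwinnertonDyer.Rank1Residual.Additive.X4SharpUnitFreeResidue
import HarnessLib

/-!
# X4♯ REDUCED TO ITS RESIDUES WITHOUT the MANIN♭ piece: the end-state map of class X4 at every odd
# `p` on the Manin-free Kato reading (cell `b2b-bsdres`, seat additive-p4, GEN 18, line V34 part D;
# twin of V22 `X4SharpUnitFreeResidue{,Sharp}.lean` / p14's `…NoLemma20.lean` on the fact A161′)

HONEST FRAMING (cell `b2b-bsdres`, run/shared/lean/b2b/bsd-rank1-residual/, verbatim in every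
file): the goal of the cell is to DELETE the COMBINATION-SHAPED residual classes of the
Birch–Swinnerton-Dyer formula for ALL analytic-rank `≤ 1` elliptic curves over `ℚ` — "full BSD
formula for every rank `≤ 1` curve in class `C`" assembled STRICTLY from published theorems — so
that the rank-`≤ 1` remainder becomes exactly the CONSTRUCTION-SHAPED classes, which are TYPED
(missing-input `Prop`s), NOT attempted. This is not "finishing BSD". Seat `additive-p4`
(CLASS-OWNERS row "X3♯/X4♯ direct"): research route on the CONSTRUCTION-SHAPED class X4; theorems
only — no definition, no named fact minted; X4 stays CONSTRUCTION-SHAPED; no label or mark moves;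
nothing is booked.

## What this file proves

GEN 14's end state (`x4SharpUnitFree_iff_lower_and_residues_sharp`, p246578; `hL20`-free by p14,
p25xxxx) read: X4♯(unit-free) ⟺ LOWER ∧ EXOTIC ∧ TAM-DEFECT₂♭ ∧ ODD-SHA♭ ∧ **MANIN♭**, the last piece
being the potentially good tower rows of `W` with NO modular-parametrisation datum `D` of `W` prime to
`p` — an artefact of the Manin clause of the sharp Kato reading A161. On the MANIN-FREE reading A161′
(n1011-lit / lit-kato p252712; consumer p08 p253452; chain of record `X4RankZeroCoveredLocusManinFree`,
this seat p254033) that piece has no reason to exist. This file proves the end states WITHOUT it: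

* `x4SharpUnitFree_iff_lower_and_upperResidue_maninFree` — X4♯(unit-free) ⟺ LOWER ∧ UPPER-RESIDUE,
  the residue being the potentially good rows failing **(tower ∧ `ord_p ∏c = ord_p c_p`)** — two
  conjuncts, not three;
* `x4SharpUnitFree_iff_lower_and_residues_maninFree` — **X4♯(unit-free) ⟺ LOWER ∧ EXOTIC ∧
  TAM-DEFECT** (FOUR named facts `hKatoMF hDel hmodD hKatoχ` + GZK + modularity);
* `x4SharpUnitFree_iff_lower_and_residues_of_casselsTate_maninFree` — with Cassels–Tate `hCT`:
  **⟺ LOWER ∧ EXOTIC ∧ TAM-DEFECT₂ ∧ ODD-SHA**;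
* `x4SharpUnitFree_iff_lower_and_residues_sharp_maninFree` — with Kato's component reading `hK`
  (additive-p2) the (G-ord, `e = 2`) rows leave the upper residues: **⟺ LOWER ∧ EXOTIC ∧ TAM-DEFECT₂♭
  ∧ ODD-SHA♭**; `…_sharp_exoticFlat_maninFree` (EXOTIC♭ too, p14's `exotic_iff_exotic_of_not_typeGOrd_two`);
* **`x4Sharp_iff_residues_maninFree`** — THE END-STATE MAP OF CLASS X4 on SIX named facts
  (`hCT hKatoMF hDel hmodD hKatoχ hK`) + GZK + modularity:
  **X4♯ ⟺ LOWER ∧ EXOTIC♭ ∧ TAM-DEFECT₂♭ ∧ ODD-SHA♭ ∧ X4♯(r = 1) ∧ NON-SURJ** — no MANIN piece, no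
  `hL20`, no image clause beyond surj(p) itself.

Proof bodies are V22's with the covered locus served by `X4RankZero.missingUpperBoundAt_of_facts_maninFree`
and the parity step by `X4RankZero.missingUpperBoundAt_of_katoManinFree_of_casselsTate_of_tamDefect_le_one_of_even`.
Census note (EVIDENCE, not used): MANIN♭ was census-empty (every window / sweep row Cremona-optimal
with `c = 1`); the content is class-level. The flag `Kato-14.5(3)-14.16(2)-additive-potgood-reading-sharp`
(tier D reading-fact) travels with every theorem. Nothing booked.

References: Kato 2004 [Kato2004Asterisque] Thm. 14.5 (3), Prop. 14.16 (2), Thm. 17.4 (3); Delbourgo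
1998 [Delbourgo1998] Prop. 4; Cassels 1962 / Silverman *AEC* X.4.14 [SilvermanAEC2009]; Serre 1972
[Serre1972] IV §3.4; Kim 2026 [Kim2022StructureSelmer] Conj. 1.10; Miller 2011 [Miller2011LMS] Def. 1.1.
-/

noncomputable section

open scoped Classical

open WeierstrassCurve Literature.NumberTheory.EllipticCurves
  Literature.NumberTheory.EllipticCurves.ModularForms
  Literature.NumberTheory.EllipticCurves.Rank1Residual
  Literature.NumberTheory.EllipticCurves.Rank1Residual.Typed

namespace Summit.BirchSwinnertonDyer.Rank1Residual.Additive

/-- **X4♯(unit-free) ⟺ LOWER ∧ UPPER-RESIDUE, MANIN-FREE** (four named facts + GZK + modularity):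
the UPPER-RESIDUE is the set of potentially good pairs failing (tower ∧ `ord_p ∏ c_ℓ = ord_p c_p`) —
NO datum clause. [cite: Kato2004Asterisque, Thm. 14.5 (3) (p. 236), Thm. 17.4 (3) (p. 273)]
[cite: Delbourgo1998, Prop. 4 (p. 144)] [cite: Miller2011LMS, Def. 1.1] -/
theorem x4SharpUnitFree_iff_lower_and_upperResidue_maninFree
    (hKatoMF : Kato2004.rankZero_padicValNat_sha_le_sub_localTamagawa_of_additive_potGood_of_imageContainsSL2_maninFree)
    (hDel : Delbourgo1998.prop4_rankZero_pow_dvd_constantCoeff)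
    (hGZK : rank_eq_analyticRank_of_analyticRank_le_one) (hmod : hasEntireLFunction_rat)
    (hmodD : nonempty_modularParametrizationData)
    (hKatoχ : Wuthrich2014.kato_halfEigenCharIdeal_dvd_cyclotomicPrime_of_surjective) :
    X4SharpUnitFree ↔
      (∀ (W : WeierstrassCurve ℚ) [W.IsElliptic] [W.IsGloballyMinimal] (p : ℕ) [Fact p.Prime],
          W.analyticRank = 0 → ClassX4 W p → Surj W p → MissingLowerBoundAt W p) ∧
      (∀ (W : WeierstrassCurve ℚ) [W.IsElliptic] [W.IsGloballyMinimal] (p : ℕ) [Fact p.Prime],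
          W.analyticRank = 0 → ClassX4 W p → Surj W p → 0 ≤ padicValRat p W.j →
          ¬ ((∀ n : ℕ, W.HasSurjectiveModNGaloisRep (p ^ n : ℕ)) ∧
              padicValNat p W.tamagawaProduct =
                padicValNat p ((W.baseChange ℚ_[p]).localTamagawaNumber ℤ_[p])) →
          MissingUpperBoundAt W p) := by
  constructor
  · intro h
    exact ⟨fun V _ _ p _ hr hX hs ↦ (lower_and_upper_of_missingPPartAt V p (h V p hr hX hs)).1,
      fun V _ _ p _ hr hX hs _ _ ↦ (lower_and_upper_of_missingPPartAt V p (h V p hr hX hs)).2⟩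
  · rintro ⟨hlow, hres⟩ V _ _ p _ hr hX hs
    refine missingPPartAt_of_lower_of_upper V p (hlow V p hr hX hs) ?_
    by_cases hj : padicValRat p V.j < 0
    · exact X4RankZero.missingUpperBoundAt_of_facts_maninFree V p hKatoMF hDel hGZK hmod hmodD hKatoχ hr
        hX hs (Or.inl hj)
    · by_cases hcert : (∀ n : ℕ, V.HasSurjectiveModNGaloisRep (p ^ n : ℕ)) ∧
          padicValNat p V.tamagawaProduct =
            padicValNat p ((V.baseChange ℚ_[p]).localTamagawaNumber ℤ_[p])
      · exact X4RankZero.missingUpperBoundAt_of_facts_maninFree V p hKatoMF hDel hGZK hmod hmodD hKatoχ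
          hr hX hs (Or.inr hcert)
      · exact hres V p hr hX hs (not_lt.mp hj) hcert

/-- **X4♯(unit-free) ⟺ LOWER ∧ EXOTIC ∧ TAM-DEFECT — THREE pieces, MANIN-FREE**: EXOTIC = the
`p = 3` potentially good surj(3) rows with no `3`-adic tower (Serre kills `¬tower` at `p ≥ 5`),
TAM-DEFECT = `ord_p ∏ c_ℓ ≠ ord_p c_p`. [cite: Kato2004Asterisque, Thm. 14.5 (3) (p. 236), Thm. 17.4 (3) (p. 273)]
[cite: Delbourgo1998, Prop. 4 (p. 144)] [cite: Serre1972, IV §3.4] [cite: Kim2022StructureSelmer, Conj. 1.10 (PDF p. 8)]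
[cite: Miller2011LMS, Def. 1.1] -/
theorem x4SharpUnitFree_iff_lower_and_residues_maninFree
    (hKatoMF : Kato2004.rankZero_padicValNat_sha_le_sub_localTamagawa_of_additive_potGood_of_imageContainsSL2_maninFree)
    (hDel : Delbourgo1998.prop4_rankZero_pow_dvd_constantCoeff)
    (hGZK : rank_eq_analyticRank_of_analyticRank_le_one) (hmod : hasEntireLFunction_rat)
    (hmodD : nonempty_modularParametrizationData)
    (hKatoχ : Wuthrich2014.kato_halfEigenCharIdeal_dvd_cyclotomicPrime_of_surjective) :
    X4SharpUnitFree ↔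
      (∀ (W : WeierstrassCurve ℚ) [W.IsElliptic] [W.IsGloballyMinimal] (p : ℕ) [Fact p.Prime],
          W.analyticRank = 0 → ClassX4 W p → Surj W p → MissingLowerBoundAt W p) ∧
      (∀ (W : WeierstrassCurve ℚ) [W.IsElliptic] [W.IsGloballyMinimal],
          W.analyticRank = 0 → ClassX4 W 3 → Surj W 3 → 0 ≤ padicValRat 3 W.j →
          ¬ (∀ n : ℕ, W.HasSurjectiveModNGaloisRep (3 ^ n : ℕ)) → MissingUpperBoundAt W 3) ∧
      (∀ (W : WeierstrassCurve ℚ) [W.IsElliptic] [W.IsGloballyMinimal] (p : ℕ) [Fact p.Prime],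
          W.analyticRank = 0 → ClassX4 W p → Surj W p → 0 ≤ padicValRat p W.j →
          padicValNat p W.tamagawaProduct ≠
            padicValNat p ((W.baseChange ℚ_[p]).localTamagawaNumber ℤ_[p]) →
          MissingUpperBoundAt W p) := by
  rw [x4SharpUnitFree_iff_lower_and_upperResidue_maninFree hKatoMF hDel hGZK hmod hmodD hKatoχ]
  refine and_congr_right fun _ ↦ ⟨fun hres ↦ ⟨?_, ?_⟩, ?_⟩
  · intro V _ _ hr hX hs hj htower
    exact hres V 3 hr hX hs hj fun h ↦ htower h.1
  · intro V _ _ p _ hr hX hs hj htam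
    exact hres V p hr hX hs hj fun h ↦ htam h.2
  · rintro ⟨hexotic, htamDefect⟩ V _ _ p hpi hr hX hs hj hcert
    by_cases htower : ∀ n : ℕ, V.HasSurjectiveModNGaloisRep (p ^ n : ℕ)
    · by_cases htam : padicValNat p V.tamagawaProduct =
          padicValNat p ((V.baseChange ℚ_[p]).localTamagawaNumber ℤ_[p])
      · exact absurd ⟨htower, htam⟩ hcert
      · exact htamDefect V p hr hX hs hj htam
    · rcases eq_three_or_five_le_of_classX4 V p hX with h3 | h5
      · subst h3
        exact hexotic V hr hX hs hj htower
      · exact absurd (serre_hasSurjectiveModNGaloisRep_pow_holds V p h5 hs) htower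

/-- **X4♯(unit-free) ⟺ LOWER ∧ EXOTIC ∧ TAM-DEFECT₂ ∧ ODD-SHA, MANIN-FREE** (Cassels–Tate `hCT` + four
named facts + GZK + modularity): parity shrinks TAM-DEFECT to the defect-`≥ 2` rows
(`ord_p ∏c ≥ v_p(c_p) + 2`) plus the rows with `ord_p #Ш_an` ODD (conjecturally none: `#Ш` is a square).
[cite: Kato2004Asterisque, Thm. 14.5 (3) (p. 236), Thm. 17.4 (3) (p. 273)] [cite: SilvermanAEC2009, Thm. X.4.14]
[cite: Delbourgo1998, Prop. 4 (p. 144)] [cite: Kim2022StructureSelmer, Conj. 1.10 (PDF p. 8)] [cite: Miller2011LMS, Def. 1.1] -/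
theorem x4SharpUnitFree_iff_lower_and_residues_of_casselsTate_maninFree
    (hCT : exists_casselsTate_pairing (K := ℚ))
    (hKatoMF : Kato2004.rankZero_padicValNat_sha_le_sub_localTamagawa_of_additive_potGood_of_imageContainsSL2_maninFree)
    (hDel : Delbourgo1998.prop4_rankZero_pow_dvd_constantCoeff)
    (hGZK : rank_eq_analyticRank_of_analyticRank_le_one) (hmod : hasEntireLFunction_rat)
    (hmodD : nonempty_modularParametrizationData)
    (hKatoχ : Wuthrich2014.kato_halfEigenCharIdeal_dvd_cyclotomicPrime_of_surjective) :
    X4SharpUnitFree ↔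
      (∀ (W : WeierstrassCurve ℚ) [W.IsElliptic] [W.IsGloballyMinimal] (p : ℕ) [Fact p.Prime],
          W.analyticRank = 0 → ClassX4 W p → Surj W p → MissingLowerBoundAt W p) ∧
      (∀ (W : WeierstrassCurve ℚ) [W.IsElliptic] [W.IsGloballyMinimal],
          W.analyticRank = 0 → ClassX4 W 3 → Surj W 3 → 0 ≤ padicValRat 3 W.j →
          ¬ (∀ n : ℕ, W.HasSurjectiveModNGaloisRep (3 ^ n : ℕ)) → MissingUpperBoundAt W 3) ∧
      (∀ (W : WeierstrassCurve ℚ) [W.IsElliptic] [W.IsGloballyMinimal] (p : ℕ) [Fact p.Prime],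
          W.analyticRank = 0 → ClassX4 W p → Surj W p → 0 ≤ padicValRat p W.j →
          padicValNat p ((W.baseChange ℚ_[p]).localTamagawaNumber ℤ_[p]) + 2 ≤
            padicValNat p W.tamagawaProduct →
          MissingUpperBoundAt W p) ∧
      (∀ (W : WeierstrassCurve ℚ) [W.IsElliptic] [W.IsGloballyMinimal] (p : ℕ) [Fact p.Prime],
          W.analyticRank = 0 → ClassX4 W p → Surj W p → 0 ≤ padicValRat p W.j →
          (∃ q : ℚ, shaAn W = (q : ℂ) ∧ Odd (padicValRat p q)) → MissingUpperBoundAt W p) := by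
  rw [x4SharpUnitFree_iff_lower_and_residues_maninFree hKatoMF hDel hGZK hmod hmodD hKatoχ]
  refine and_congr_right fun _ ↦ and_congr_right fun hexotic ↦ ⟨fun htam ↦ ⟨?_, ?_⟩, ?_⟩
  · intro V _ _ p _ hr hX hs hj h2
    exact htam V p hr hX hs hj (by omega)
  · intro V _ _ p _ hr hX hs hj ⟨q, hq, hodd⟩
    by_cases htamEq : padicValNat p V.tamagawaProduct =
        padicValNat p ((V.baseChange ℚ_[p]).localTamagawaNumber ℤ_[p])
    · by_cases htower : ∀ n : ℕ, V.HasSurjectiveModNGaloisRep (p ^ n : ℕ)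
      · exact X4RankZero.missingUpperBoundAt_of_katoManinFree V p hKatoMF hGZK hmod hr hX hj htower htamEq
      · rcases eq_three_or_five_le_of_classX4 V p hX with h3 | h5
        · subst h3
          exact hexotic V hr hX hs hj htower
        · exact absurd (serre_hasSurjectiveModNGaloisRep_pow_holds V p h5 hs) htower
    · exact htam V p hr hX hs hj htamEq
  · rintro ⟨htam2, hoddSha⟩
    intro V _ _ p _ hr hX hs hj htamNe
    by_cases htower : ∀ n : ℕ, V.HasSurjectiveModNGaloisRep (p ^ n : ℕ)
    · obtain ⟨q, hq, hle⟩ :=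
        X4RankZero.padicValNat_shaOrder_le_of_katoManinFree V p hKatoMF hGZK hmod hr hX hj htower
      by_cases h1 : padicValNat p V.tamagawaProduct ≤
          padicValNat p ((V.baseChange ℚ_[p]).localTamagawaNumber ℤ_[p]) + 1
      · rcases Int.even_or_odd (padicValRat p q) with heven | hodd
        · exact X4RankZero.missingUpperBoundAt_of_katoManinFree_of_casselsTate_of_tamDefect_le_one_of_even
            V p hCT hKatoMF hGZK hmod hr hX hj htower h1 hq heven
        · exact hoddSha V p hr hX hs hj ⟨q, hq, hodd⟩
      · exact htam2 V p hr hX hs hj (by omega)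
    · rcases eq_three_or_five_le_of_classX4 V p hX with h3 | h5
      · subst h3
        exact hexotic V hr hX hs hj htower
      · exact absurd (serre_hasSurjectiveModNGaloisRep_pow_holds V p h5 hs) htower

/-- **X4♯(unit-free) ⟺ LOWER ∧ EXOTIC ∧ TAM-DEFECT₂♭ ∧ ODD-SHA♭, MANIN-FREE** (SIX named facts:
`hCT hKatoMF hDel hmodD hKatoχ hK` + GZK + modularity): the (G-ord, `e = 2`) rows leave the upper
residues by Kato's component reading (additive-p2, `ClassX4Gord.missingUpperBoundAt_rankZero_of_katoComponent_of_surj`).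
[cite: Kato2004Asterisque, Thm. 14.5 (3) (p. 236), Thm. 17.4 (3) (p. 273)] [cite: Delbourgo1998, Prop. 4 (p. 144)]
[cite: SilvermanAEC2009, Thm. X.4.14] [cite: Kim2022StructureSelmer, Conj. 1.10 (PDF p. 8)] [cite: Miller2011LMS, Def. 1.1] -/
theorem x4SharpUnitFree_iff_lower_and_residues_sharp_maninFree
    (hCT : exists_casselsTate_pairing (K := ℚ))
    (hKatoMF : Kato2004.rankZero_padicValNat_sha_le_sub_localTamagawa_of_additive_potGood_of_imageContainsSL2_maninFree)
    (hDel : Delbourgo1998.prop4_rankZero_pow_dvd_constantCoeff)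
    (hGZK : rank_eq_analyticRank_of_analyticRank_le_one) (hmod : hasEntireLFunction_rat)
    (hmodD : nonempty_modularParametrizationData)
    (hKatoχ : Wuthrich2014.kato_halfEigenCharIdeal_dvd_cyclotomicPrime_of_surjective)
    (hK : Kato2004.charIdeal_dvd_padicLFunctionBranch_component_of_surjective) :
    X4SharpUnitFree ↔
      (∀ (W : WeierstrassCurve ℚ) [W.IsElliptic] [W.IsGloballyMinimal] (p : ℕ) [Fact p.Prime],
          W.analyticRank = 0 → ClassX4 W p → Surj W p → MissingLowerBoundAt W p) ∧
      (∀ (W : WeierstrassCurve ℚ) [W.IsElliptic] [W.IsGloballyMinimal],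
          W.analyticRank = 0 → ClassX4 W 3 → Surj W 3 → 0 ≤ padicValRat 3 W.j →
          ¬ (∀ n : ℕ, W.HasSurjectiveModNGaloisRep (3 ^ n : ℕ)) → MissingUpperBoundAt W 3) ∧
      (∀ (W : WeierstrassCurve ℚ) [W.IsElliptic] [W.IsGloballyMinimal] (p : ℕ) [Fact p.Prime],
          W.analyticRank = 0 → ClassX4 W p → Surj W p → 0 ≤ padicValRat p W.j →
          ¬ (TypeGOrd W p ∧ semistabilityIndex W p = 2) →
          padicValNat p ((W.baseChange ℚ_[p]).localTamagawaNumber ℤ_[p]) + 2 ≤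
            padicValNat p W.tamagawaProduct →
          MissingUpperBoundAt W p) ∧
      (∀ (W : WeierstrassCurve ℚ) [W.IsElliptic] [W.IsGloballyMinimal] (p : ℕ) [Fact p.Prime],
          W.analyticRank = 0 → ClassX4 W p → Surj W p → 0 ≤ padicValRat p W.j →
          ¬ (TypeGOrd W p ∧ semistabilityIndex W p = 2) →
          (∃ q : ℚ, shaAn W = (q : ℂ) ∧ Odd (padicValRat p q)) → MissingUpperBoundAt W p) := by
  rw [x4SharpUnitFree_iff_lower_and_residues_of_casselsTate_maninFree hCT hKatoMF hDel hGZK hmod hmodD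
    hKatoχ]
  refine and_congr_right fun _ ↦ and_congr_right fun _ ↦ ?_
  constructor
  · rintro ⟨htam, hodd⟩
    exact ⟨fun V _ _ p _ hr hX hs hj _ h2 ↦ htam V p hr hX hs hj h2,
      fun V _ _ p _ hr hX hs hj _ ho ↦ hodd V p hr hX hs hj ho⟩
  · rintro ⟨htam, hodd⟩
    refine ⟨fun V _ _ p _ hr hX hs hj h2 ↦ ?_, fun V _ _ p _ hr hX hs hj ho ↦ ?_⟩
    · by_cases hG : TypeGOrd V p ∧ semistabilityIndex V p = 2
      · exact ClassX4Gord.missingUpperBoundAt_rankZero_of_katoComponent_of_surj hK hDel hGZK hmod hmodD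
          ⟨hX, hG.1⟩ hG.2 hr hs
      · exact htam V p hr hX hs hj hG h2
    · by_cases hG : TypeGOrd V p ∧ semistabilityIndex V p = 2
      · exact ClassX4Gord.missingUpperBoundAt_rankZero_of_katoComponent_of_surj hK hDel hGZK hmod hmodD
          ⟨hX, hG.1⟩ hG.2 hr hs
      · exact hodd V p hr hX hs hj hG ho

/-- **X4♯(unit-free) ⟺ LOWER ∧ EXOTIC♭ ∧ TAM-DEFECT₂♭ ∧ ODD-SHA♭, MANIN-FREE** — the EXOTIC piece also
off the (G-ord, `e = 2`) rows (p14's `exotic_iff_exotic_of_not_typeGOrd_two`). Six named facts.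
[cite: Kato2004Asterisque, Thm. 14.5 (3) (p. 236), Thm. 17.4 (3) (p. 273)] [cite: Delbourgo1998, Prop. 4 (p. 144)]
[cite: SilvermanAEC2009, Thm. X.4.14] [cite: Kim2022StructureSelmer, Conj. 1.10 (PDF p. 8)] [cite: Miller2011LMS, Def. 1.1] -/
theorem x4SharpUnitFree_iff_lower_and_residues_sharp_exoticFlat_maninFree
    (hCT : exists_casselsTate_pairing (K := ℚ))
    (hKatoMF : Kato2004.rankZero_padicValNat_sha_le_sub_localTamagawa_of_additive_potGood_of_imageContainsSL2_maninFree)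
    (hDel : Delbourgo1998.prop4_rankZero_pow_dvd_constantCoeff)
    (hGZK : rank_eq_analyticRank_of_analyticRank_le_one) (hmod : hasEntireLFunction_rat)
    (hmodD : nonempty_modularParametrizationData)
    (hKatoχ : Wuthrich2014.kato_halfEigenCharIdeal_dvd_cyclotomicPrime_of_surjective)
    (hK : Kato2004.charIdeal_dvd_padicLFunctionBranch_component_of_surjective) :
    X4SharpUnitFree ↔
      (∀ (W : WeierstrassCurve ℚ) [W.IsElliptic] [W.IsGloballyMinimal] (p : ℕ) [Fact p.Prime],
          W.analyticRank = 0 → ClassX4 W p → Surj W p → MissingLowerBoundAt W p) ∧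
      (∀ (W : WeierstrassCurve ℚ) [W.IsElliptic] [W.IsGloballyMinimal],
          W.analyticRank = 0 → ClassX4 W 3 → Surj W 3 → 0 ≤ padicValRat 3 W.j →
          ¬ (TypeGOrd W 3 ∧ semistabilityIndex W 3 = 2) →
          ¬ (∀ n : ℕ, W.HasSurjectiveModNGaloisRep (3 ^ n : ℕ)) → MissingUpperBoundAt W 3) ∧
      (∀ (W : WeierstrassCurve ℚ) [W.IsElliptic] [W.IsGloballyMinimal] (p : ℕ) [Fact p.Prime],
          W.analyticRank = 0 → ClassX4 W p → Surj W p → 0 ≤ padicValRat p W.j →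
          ¬ (TypeGOrd W p ∧ semistabilityIndex W p = 2) →
          padicValNat p ((W.baseChange ℚ_[p]).localTamagawaNumber ℤ_[p]) + 2 ≤
            padicValNat p W.tamagawaProduct →
          MissingUpperBoundAt W p) ∧
      (∀ (W : WeierstrassCurve ℚ) [W.IsElliptic] [W.IsGloballyMinimal] (p : ℕ) [Fact p.Prime],
          W.analyticRank = 0 → ClassX4 W p → Surj W p → 0 ≤ padicValRat p W.j →
          ¬ (TypeGOrd W p ∧ semistabilityIndex W p = 2) →
          (∃ q : ℚ, shaAn W = (q : ℂ) ∧ Odd (padicValRat p q)) → MissingUpperBoundAt W p) := by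
  rw [x4SharpUnitFree_iff_lower_and_residues_sharp_maninFree hCT hKatoMF hDel hGZK hmod hmodD hKatoχ hK,
    exotic_iff_exotic_of_not_typeGOrd_two]

/-- **THE END-STATE MAP OF CLASS X4, MANIN-FREE, on SIX named facts: X4♯ ⟺ LOWER ∧ EXOTIC♭ ∧
TAM-DEFECT₂♭ ∧ ODD-SHA♭ ∧ X4♯(r = 1) ∧ NON-SURJ** — what no published theorem reaches is exactly
(rank 0, surjective) the LOWER half everywhere and the UPPER half on the exotic-`3`-adic rows and on the
Tamagawa-defect-`≥ 2` / odd-`#Ш_an` rows off (G-ord, `e = 2`) — Kim's Conjecture 1.10's `≥`-half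
there —, (rank 1) all of X4♯(r = 1), and the non-surjective rows (O8). No Manin / optimality clause,
no `hL20`. Binders: `hCT`, `hKatoMF`, `hDel`, `hGZK`, `hmod`, `hmodD`, `hKatoχ`, `hK`.
[cite: Kato2004Asterisque, Thm. 14.5 (3) (p. 236), Thm. 17.4 (3) (p. 273)] [cite: Delbourgo1998, Prop. 4 (p. 144)]
[cite: SilvermanAEC2009, Thm. X.4.14] [cite: Kim2022StructureSelmer, Conj. 1.10 (PDF p. 8)] [cite: Miller2011LMS, Def. 1.1] -/
theorem x4Sharp_iff_residues_maninFree
    (hCT : exists_casselsTate_pairing (K := ℚ))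
    (hKatoMF : Kato2004.rankZero_padicValNat_sha_le_sub_localTamagawa_of_additive_potGood_of_imageContainsSL2_maninFree)
    (hDel : Delbourgo1998.prop4_rankZero_pow_dvd_constantCoeff)
    (hGZK : rank_eq_analyticRank_of_analyticRank_le_one) (hmod : hasEntireLFunction_rat)
    (hmodD : nonempty_modularParametrizationData)
    (hKatoχ : Wuthrich2014.kato_halfEigenCharIdeal_dvd_cyclotomicPrime_of_surjective)
    (hK : Kato2004.charIdeal_dvd_padicLFunctionBranch_component_of_surjective) :
    X4Sharp ↔
      (∀ (W : WeierstrassCurve ℚ) [W.IsElliptic] [W.IsGloballyMinimal] (p : ℕ) [Fact p.Prime],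
          W.analyticRank = 0 → ClassX4 W p → Surj W p → MissingLowerBoundAt W p) ∧
      (∀ (W : WeierstrassCurve ℚ) [W.IsElliptic] [W.IsGloballyMinimal],
          W.analyticRank = 0 → ClassX4 W 3 → Surj W 3 → 0 ≤ padicValRat 3 W.j →
          ¬ (TypeGOrd W 3 ∧ semistabilityIndex W 3 = 2) →
          ¬ (∀ n : ℕ, W.HasSurjectiveModNGaloisRep (3 ^ n : ℕ)) → MissingUpperBoundAt W 3) ∧
      (∀ (W : WeierstrassCurve ℚ) [W.IsElliptic] [W.IsGloballyMinimal] (p : ℕ) [Fact p.Prime],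
          W.analyticRank = 0 → ClassX4 W p → Surj W p → 0 ≤ padicValRat p W.j →
          ¬ (TypeGOrd W p ∧ semistabilityIndex W p = 2) →
          padicValNat p ((W.baseChange ℚ_[p]).localTamagawaNumber ℤ_[p]) + 2 ≤
            padicValNat p W.tamagawaProduct →
          MissingUpperBoundAt W p) ∧
      (∀ (W : WeierstrassCurve ℚ) [W.IsElliptic] [W.IsGloballyMinimal] (p : ℕ) [Fact p.Prime],
          W.analyticRank = 0 → ClassX4 W p → Surj W p → 0 ≤ padicValRat p W.j →
          ¬ (TypeGOrd W p ∧ semistabilityIndex W p = 2) →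
          (∃ q : ℚ, shaAn W = (q : ℂ) ∧ Odd (padicValRat p q)) → MissingUpperBoundAt W p) ∧
      X4SharpRankOne ∧
      (∀ (W : WeierstrassCurve ℚ) [W.IsElliptic] [W.IsGloballyMinimal] (p : ℕ) [Fact p.Prime],
          W.analyticRank ≤ 1 → ClassX4 W p → ¬ Surj W p → MissingPPartAt W p) := by
  rw [x4Sharp_iff_unitFree_and_rankOne_and_nonSurj,
    x4SharpUnitFree_iff_lower_and_residues_sharp_exoticFlat_maninFree hCT hKatoMF hDel hGZK hmod hmodD
      hKatoχ hK]
  simp only [and_assoc]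

end Summit.BirchSwinnertonDyer.Rank1Residual.Additive

end
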